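import Summits.BirchSwinnertonDyer.BirchSwinnertonDyer.Theorems.ErratumRoadFiveShimuraKolyvaginOrderBoundInertCarrierLabels
import Summits.BirchSwinnertonDyer.Rank1Residual.X11b.RingClassFieldConj
import Summits.BirchSwinnertonDyer.Rank1Residual.X11b.KolyvaginH44ConcreteData
import Literature.NumberTheory.EllipticCurves.HeegnerPointReflectionProofs
import Literature.NumberTheory.EllipticCurves.RingClassFieldConjugation
import HarnessLib

/-!
# The `K`-level complex-conjugation label (B3₀) of a Shimura–Heegner family is a CONSEQUENCE of
# the level-`1` conjugation label (B3) and the bottom trace label (B2) — one printed primitive fewer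

Cell `bsd-stepL` (run/shared/lean/pub/bsd-stepL/), seat `bsd-stepL-shim-p2` (prover g5). Summit-side
THEOREM-ONLY helper (no definition, no named fact, no `sorry`); `K : Type`; nothing depends on a prime.

The PRIMITIVES statements that the cell HOLDS as printed asides for the Shimura–Kolyvagin cruxes — shim-p1's
`hLab` (crux 19718, K4e `hpointsRk_of_shimuraLabels` p494992 ∕ K5 p495703), shim3a's π₃ (crux 19899,
p496956) and this seat's `hLabF` (p497782) — carry, next to the bottom trace (B2)
`y_K ↑ K[1] = Σ_{g ∈ 𝒢_1} g·y(1)` (Gross 1991 (4.1); BD96 §2.5) and the level-`m` conjugation label (B3)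
`τ_m y(m) − ε σ' y(m)` torsion for some `σ' ∈ 𝒢_m` (Gross 1991 Prop. 5.3; BD96 Prop. 2.6), a SEPARATE
`K`-level label (B3₀): `c y_K − ε y_K` torsion for the non-trivial `c ∈ Aut(K/ℚ)` (x11b3 takes it as
Darmon 2004 Prop. 3.11 on `X₀(N)`). This file proves (B3₀) ⟸ (B3) at `m = 1` + (B2), by Galois
bookkeeping inside `K[1] ⊂ ℂ`: with `τ = τ_1` the restriction of complex conjugation
(`RingClassConj.exists_conj_algEquiv`), `τ ∘ (K → K[1]) = (K → K[1]) ∘ c`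
(`comp_eq_conjugate_of_ne_id`), so `(c y_K)↑ = τ·(y_K↑) = Σ_g (τg)·y(1) = Σ_g g·(τ y(1))` (`τ`
normalises `𝒢_1`, `RingClassConj.conj_mul_mul_inv_mem_ringClassGal`) `= ε Σ_g (gσ')·y(1) + Σ_g g·t =
ε y_K↑ + t'` with `t`, hence `t'`, of finite order; `E(K) → E(K[1])` is injective. So the asides can
drop (B3₀) (consumers feed K4e's `hB3K` with this theorem) — planner's ∕ referee's call; nothing is
re-filed by this file.

HONEST FRAMING: a kernel lemma about bare data; discharges nothing on any crux by itself; no census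
number moves (T7).
[cite: GrossLMS1991, §3 (p. 238: τ), §4 (4.1), §5 Prop. 5.3] [cite: BertoliniDarmon1996, §2.5, Prop. 2.6]
[cite: Cox2013, §9.A Lemma 9.3] [cite: Darmon2004, Prop. 3.11]
presearch: `lean search 'IsOfFinAddOrder (WeierstrassCurve.Affine.Point.map'` → x11b3 `KolyvaginHpointsAssembly`
(X₀(N), from Darmon 3.11 by name) and the three PRIMITIVES binders (hypothesis hB3K) — no derivation; corpus ∕ galaxy:
Gross 1991 §5 derives the eigen-property of `y_K` from Prop. 5.3 at `n = 1` exactly this way (book:editornd-l-functions-arithmetic p. 247).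
-/

noncomputable section

open scoped Classical

set_option linter.dupNamespace false

namespace Summit.BirchSwinnertonDyer.BirchSwinnertonDyer.Theorems.ShimuraKolyvaginConjKLevel

open WeierstrassCurve Field NumberField IsDedekindDomain Finset
  Literature.NumberTheory.EllipticCurves Literature.NumberTheory.GaloisRepresentations
  Literature.NumberTheory.EllipticCurves.KolyvaginCocycle
  Literature.NumberTheory.EllipticCurves.KolyvaginEuler
  Literature.NumberTheory.EllipticCurves.RingClassField
  Literature.NumberTheory.EllipticCurves.ModularForms
  Summit.BirchSwinnertonDyer.Rank1Residual.X11b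

variable {K : Type} [Field K] [NumberField K] {W : WeierstrassCurve ℚ}

/-- **(B3₀) from (B3) at level `1` and (B2).** For `K` imaginary quadratic, `ι : K → ℂ`, a family
`y(m) ∈ E(K[m])`, a point `y_K ∈ E(K)` and `ε ∈ ℤ` with (B2) `y_K ↑ K[1] = Σ_{g ∈ 𝒢_1} g·y(1)` and (B3) at
`m = 1` (for every conjugation automorphism `τ₁` of `K[1]` some `σ' ∈ 𝒢_1` has `τ₁ y(1) − ε σ' y(1)` of
finite order): for every non-trivial `c ∈ Aut_ℚ(K)`, `c·y_K − ε·y_K` has finite order.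
[cite: GrossLMS1991, §4 (4.1), §5 Prop. 5.3] [cite: BertoliniDarmon1996, §2.5, Prop. 2.6] -/
theorem isOfFinAddOrder_map_sub_smul_of_labels (hK : IsImaginaryQuadratic K) (ι : K →+* ℂ)
    (y : (m : ℕ) → (W.baseChange (ringClassField K ι m)).toAffine.Point)
    {yK : (W.baseChange K).toAffine.Point} {ε : ℤ}
    (hB2 : ∀ T : Finset (ringClassField K ι 1 ≃ₐ[ℚ] ringClassField K ι 1),
      (∀ g, g ∈ T ↔ g ∈ ringClassGal ι 1) →
      WeierstrassCurve.Affine.Point.map (W' := W)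
          (algebraMap K (ringClassField K ι 1)).toRatAlgHom yK =
        ∑ g ∈ T, pointGalHom W (ringClassField K ι 1) g (y 1))
    (hB3 : ∀ (m : ℕ), m ≠ 0 → ∀ τm : ringClassField K ι m ≃ₐ[ℚ] ringClassField K ι m,
      (∀ x : ringClassField K ι m, ((τm x : ringClassField K ι m) : ℂ) = starRingEnd ℂ x) →
      ∃ σ' ∈ ringClassGal ι m, IsOfFinAddOrder
        (pointGalHom W (ringClassField K ι m) τm (y m) -
          ε • pointGalHom W (ringClassField K ι m) σ' (y m))) :
    ∀ c : K ≃ₐ[ℚ] K, c ≠ 1 →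
      IsOfFinAddOrder (WeierstrassCurve.Affine.Point.map (W' := W) (c : K →ₐ[ℚ] K) yK - ε • yK) := by
  intro c hc
  -- notation
  set L := ringClassField K ι 1 with hL
  let up : (W.baseChange K).toAffine.Point →+ (W.baseChange L).toAffine.Point :=
    WeierstrassCurve.Affine.Point.map (W' := W) (algebraMap K L).toRatAlgHom
  let ρ := pointGalHom W L
  have hρmul : ∀ (a b : L ≃ₐ[ℚ] L) (P : (W.baseChange L).toAffine.Point),
      ρ (a * b) P = ρ a (ρ b P) := fun a b P ↦ by
    change (pointGalHom W L (a * b)) P = _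
    rw [map_mul]; rfl
  -- the conjugation automorphism `τ` of `K[1]`
  obtain ⟨τ, hτ⟩ := RingClassConj.exists_conj_algEquiv hK ι (n := 1) one_ne_zero
  -- Step A: `τ ∘ (K → K[1]) = (K → K[1]) ∘ c`
  have hcσ : (c : K →ₐ[ℚ] K) ≠ AlgHom.id ℚ K := by
    intro h; apply hc; ext k; exact DFunLike.congr_fun h k
  have hιc : ∀ k : K, ι (c k) = starRingEnd ℂ (ι k) := fun k ↦ by
    have := congrArg (fun f : K →+* ℂ ↦ f k) (comp_eq_conjugate_of_ne_id hK ι hcσ)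
    simpa [ComplexEmbedding.conjugate_coe_eq] using this
  have hA : ∀ k : K, τ (algebraMap K L k) = algebraMap K L (c k) := fun k ↦ by
    apply Subtype.ext
    rw [hτ, coe_algebraMap_ringClassField, coe_algebraMap_ringClassField, hιc]
  -- Step B: `(c y_K)↑ = τ · (y_K↑)`
  have hB : up (WeierstrassCurve.Affine.Point.map (W' := W) (c : K →ₐ[ℚ] K) yK) = ρ τ (up yK) := by
    change WeierstrassCurve.Affine.Point.map (W' := W) _ (WeierstrassCurve.Affine.Point.map (W' := W) _ yK)
      = pointGalHom W L τ (WeierstrassCurve.Affine.Point.map (W' := W) _ yK)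
    rw [pointGalHom_apply, WeierstrassCurve.Affine.Point.map_map, WeierstrassCurve.Affine.Point.map_map]
    have hcomp : (algebraMap K L).toRatAlgHom.comp (c : K →ₐ[ℚ] K) =
        (τ : L →ₐ[ℚ] L).comp (algebraMap K L).toRatAlgHom := by
      apply AlgHom.ext
      intro k
      change algebraMap K L (c k) = τ (algebraMap K L k)
      exact (hA k).symm
    rw [hcomp]
  -- a finset enumerating `𝒢_1`
  haveI : Finite (ringClassGal ι 1) := KolyvaginH44.finite_ringClassGal hK ι 1
  have hGfin : (ringClassGal ι 1 : Set (L ≃ₐ[ℚ] L)).Finite := Set.toFinite _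
  set T : Finset (L ≃ₐ[ℚ] L) := hGfin.toFinset with hTdef
  have hT : ∀ g, g ∈ T ↔ g ∈ ringClassGal ι 1 := fun g ↦ by
    rw [hTdef, Set.Finite.mem_toFinset]; rfl
  -- (B3) at level 1
  obtain ⟨σ', hσ', hfin⟩ := hB3 1 one_ne_zero τ hτ
  set t := ρ τ (y 1) - ε • ρ σ' (y 1) with ht
  -- Step C: `τ · Σ_{g ∈ T} g·y(1) = Σ_{g ∈ T} g·(τ·y(1))`
  have hC : ρ τ (∑ g ∈ T, ρ g (y 1)) = ∑ g ∈ T, ρ g (ρ τ (y 1)) := by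
    rw [map_sum]
    -- reindex along `g ↦ τ g τ⁻¹`
    refine Finset.sum_equiv (MulAut.conj τ).toEquiv (fun g ↦ ?_) (fun g hg ↦ ?_)
    · change g ∈ T ↔ τ * g * τ⁻¹ ∈ T
      rw [hT, hT]
      refine ⟨fun hg ↦ RingClassConj.conj_mul_mul_inv_mem_ringClassGal hτ hK hg, fun hg ↦ ?_⟩
      have := RingClassConj.conj_mul_mul_inv_mem_ringClassGal hτ hK hg
      rwa [RingClassConj.conj_inv hτ, ← mul_assoc, ← mul_assoc, RingClassConj.conj_mul_self hτ, one_mul,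
        mul_assoc, RingClassConj.conj_mul_self hτ, mul_one] at this
    · change ρ τ (ρ g (y 1)) = ρ (τ * g * τ⁻¹) (ρ τ (y 1))
      rw [← hρmul, ← hρmul, inv_mul_cancel_right]
  -- Step D: `Σ_g g·(τ y(1)) = ε • Σ_g (g σ')·y(1) + Σ_g g·t` and `Σ_g (g σ')·y(1) = Σ_g g·y(1)`
  have hD1 : ∑ g ∈ T, ρ g (ρ τ (y 1)) = ε • ∑ g ∈ T, ρ (g * σ') (y 1) + ∑ g ∈ T, ρ g t := by
    have hpt : ρ τ (y 1) = ε • ρ σ' (y 1) + t := by rw [ht]; abel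
    simp_rw [hpt, map_add, map_zsmul, hρmul, Finset.sum_add_distrib, Finset.smul_sum]
  have hD2 : ∑ g ∈ T, ρ (g * σ') (y 1) = ∑ g ∈ T, ρ g (y 1) := by
    refine Finset.sum_equiv (Equiv.mulRight σ') (fun g ↦ ?_) (fun g hg ↦ rfl)
    change g ∈ T ↔ g * σ' ∈ T
    rw [hT, hT]
    exact ⟨fun hg ↦ mul_mem hg hσ', fun hg ↦ by simpa using mul_mem hg (inv_mem hσ')⟩
  -- the torsion element `t' = Σ_g g·t`
  have ht' : IsOfFinAddOrder (∑ g ∈ T, ρ g t) := by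
    refine Finset.sum_induction _ (fun P ↦ IsOfFinAddOrder P) (fun a b ha hb ↦ ha.add hb)
      IsOfFinAddOrder.zero (fun g _ ↦ ?_)
    exact (ρ g).isOfFinAddOrder hfin
  -- Step E: assemble `up (c y_K − ε y_K) = t'` and pull back along the injective `up`
  have hE : up (WeierstrassCurve.Affine.Point.map (W' := W) (c : K →ₐ[ℚ] K) yK - ε • yK) =
      ∑ g ∈ T, ρ g t := by
    rw [map_sub, map_zsmul, hB, hB2 T hT, hC, hD1, hD2]
    abel
  have hinj : Function.Injective up := WeierstrassCurve.Affine.Point.map_injective _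
  rw [← hinj.isOfFinAddOrder_iff, hE]
  exact ht'

/-- **K4e with one printed label fewer**: the depth-`k` ring-class-rational Euler system `hpointsRk` (the
conclusion of shim-p1's `hpointsRk_of_shimuraLabels`, p494992, VERBATIM) from the bare CM family `y(m)`,
`y_K`, `ε = ±1` and the FOUR labels (B2), (B3), (B4), (B5) — the `K`-level conjugation label (B3₀) (K4e's
hypothesis `hB3K`) being DERIVED by `isOfFinAddOrder_map_sub_smul_of_labels`. `p` odd, `ρ̄_{E,p}` onto, every
`d_K`, as in K4e. CONDITIONAL on the four labels (hypotheses, not discharged).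
[cite: GrossLMS1991, §§3–5] [cite: BertoliniDarmon1996, §2] [cite: Nekovar2007, (4.8), (4.9)] -/
theorem hpointsRk_of_shimuraLabels_reduced (hK : IsImaginaryQuadratic K) (ι : K →+* ℂ) {N : ℕ} [NeZero N]
    [W.IsElliptic] [W.IsGloballyMinimal] (hN : W.conductorNorm ℤ = N)
    (Dt : ModularParametrizationData W N) {p : ℕ} (hp : p.Prime) (hp2 : p ≠ 2)
    (hρ : W.HasSurjectiveModNGaloisRep p)
    (y : (m : ℕ) → (W.baseChange (ringClassField K ι m)).toAffine.Point)
    {yK : (W.baseChange K).toAffine.Point} {ε : ℤ} (hε : ε = 1 ∨ ε = -1)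
    (hB2 : ∀ T : Finset (ringClassField K ι 1 ≃ₐ[ℚ] ringClassField K ι 1),
      (∀ g, g ∈ T ↔ g ∈ ringClassGal ι 1) →
      WeierstrassCurve.Affine.Point.map (W' := W)
          (algebraMap K (ringClassField K ι 1)).toRatAlgHom yK =
        ∑ g ∈ T, pointGalHom W (ringClassField K ι 1) g (y 1))
    (hB3 : ∀ (m : ℕ), m ≠ 0 → ∀ τm : ringClassField K ι m ≃ₐ[ℚ] ringClassField K ι m,
      (∀ x : ringClassField K ι m, ((τm x : ringClassField K ι m) : ℂ) = starRingEnd ℂ x) →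
      ∃ σ' ∈ ringClassGal ι m, IsOfFinAddOrder
        (pointGalHom W (ringClassField K ι m) τm (y m) -
          ε • pointGalHom W (ringClassField K ι m) σ' (y m)))
    (hB4 : ∀ m : ℕ, Squarefree m →
      (∀ q ∈ m.primeFactors, ¬ q ∣ N ∧ (Ideal.span {(q : 𝓞 K)}).IsPrime) →
      ∀ (ℓ : ℕ) (_ : ℓ ∈ m.primeFactors) (hle : ringClassField K ι (m / ℓ) ≤ ringClassField K ι m)
        (σ : ringClassField K ι m ≃ₐ[ℚ] ringClassField K ι m),
        Subgroup.zpowers σ = ringClassGalOver ι m (m / ℓ) →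
        letI : Algebra K ℂ := ι.toAlgebra
        ∑ i ∈ Finset.range (ℓ + 1), pointGalHom W (ringClassField K ι m) (σ ^ i) (y m) =
          W.frobeniusTrace ℓ • WeierstrassCurve.Affine.Point.map (W' := W)
            ((RingClassField.inclusion ι hle).restrictScalars ℚ) (y (m / ℓ)))
    (hB5 : ∀ m : ℕ, Squarefree m →
      (∀ q ∈ m.primeFactors, ¬ q ∣ N ∧ (Ideal.span {(q : 𝓞 K)}).IsPrime) →
      ∀ (ℓ : ℕ) (_ : ℓ ∈ m.primeFactors) [Fact ℓ.Prime] (hΔ : ¬ (ℓ : ℤ) ∣ minimalDiscriminantInt W)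
        (φ₀ : absoluteGaloisGroup (ZMod ℓ)), (∀ x : AlgebraicClosure (ZMod ℓ), φ₀ • x = x ^ ℓ) →
      ∀ (hle : ringClassField K ι (m / ℓ) ≤ ringClassField K ι m)
        (emb : ringClassField K ι m →+* AlgebraicClosure K),
        (∀ x : K, emb (algebraMap K (ringClassField K ι m) x) = algebraMap K (AlgebraicClosure K) x) →
      ∀ (j : (W.baseChange (ringClassField K ι m)).toAffine.Point →+ geomPoints (W.baseChange K)),
        j = WeierstrassCurve.Affine.Point.map (W' := W) emb.toRatAlgHom →
      ∀ γ : ringClassField K ι m ≃ₐ[ℚ] ringClassField K ι m, γ ∈ ringClassGal ι m →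
        letI : Algebra K ℂ := ι.toAlgebra
        geomReduction hΔ ((RatClosure.pointsEquiv (K := K) W).symm
            (j (pointGalHom W (ringClassField K ι m) γ (y m)))) =
          φ₀ • geomReduction hΔ ((RatClosure.pointsEquiv (K := K) W).symm
            (j (pointGalHom W (ringClassField K ι m) γ
              (WeierstrassCurve.Affine.Point.map (W' := W)
                ((RingClassField.inclusion ι hle).restrictScalars ℚ) (y (m / ℓ))))))) :
    ∀ (k : ℕ) {M : ℕ} (_hM : 1 ≤ M)
      (hdiv : ∀ Q : geomPoints (W.baseChange K), ∃ R, ((p ^ M : ℕ) : ℤ) • R = Q)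
      (c : K ≃ₐ[ℚ] K) (_hc : c ≠ 1),
      ∃ (ε : ℤ) (τ : AlgebraicClosure K ≃+* AlgebraicClosure K) (hτ : IsLiftOfAut c τ)
        (A : ℕ → AddSubgroup (geomPoints (W.baseChange K)))
        (hA : ∀ m, KolyvaginCocycle.IsAdmissible (Field.absoluteGaloisGroup K) (A m)
          ((p ^ M : ℕ) : ℤ))
        (emb : ∀ m : ℕ, ringClassField K ι m →ₐ[K] AlgebraicClosure K)
        (Pt : ℕ → geomPoints (W.baseChange K))
        (hPt : ∀ m, Pt m ∈
          KolyvaginCocycle.invPoints (Field.absoluteGaloisGroup K) (A m) ((p ^ M : ℕ) : ℤ)),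
        (ε = 1 ∨ ε = -1) ∧
        IsOfFinAddOrder (Affine.Point.map (W' := W) (c : K →ₐ[ℚ] K) yK - ε • yK) ∧
        (∀ m, ∀ a ∈ A m, hτ.pointsMap W a ∈ A m) ∧
        Pt 1 = toGeomPoints (W.baseChange K) yK ∧
        (∀ m, m ≠ 0 → ∀ a ∈ A m, ∀ Φ : Field.absoluteGaloisGroup K,
          (∀ x : ringClassField K ι m, Φ • emb m x = emb m x) → Φ • a = a) ∧
        (∀ m, KolyvaginCocycle.IsAdmissible (Field.absoluteGaloisGroup K) (A m)
          ((p ^ (M + k) : ℕ) : ℤ)) ∧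
        (∀ m : ℕ, Squarefree m →
          (∀ q ∈ m.primeFactors, IsKolyvaginPrime N W K p q ∧ FrobEqFrobInfty W K (p ^ (M + k)) q) →
          Pt m ∈ KolyvaginCocycle.invPoints (Field.absoluteGaloisGroup K) (A m)
            ((p ^ (M + k) : ℕ) : ℤ) ∧
          (∃ B ∈ A m, hτ.pointsMap W (Pt m) =
            (ε * (-1) ^ m.primeFactors.card) • Pt m + ((p ^ M : ℕ) : ℤ) • B) ∧
          (∀ ℓ : ℕ, ℓ.Prime → ℓ ∣ m → ∀ v : HeightOneSpectrum (𝓞 K), (ℓ : 𝓞 K) ∈ v.asIdeal →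
            ∀ a : ℕ, (((p : ℤ) ^ a) •
                kolyvaginClass (W.baseChange K) _ hdiv (hA m) (Pt m) (hPt m) ∈
                selmerLocalKer (W.baseChange K) (v.adicCompletion K) ((p ^ M : ℕ) : ℤ) ↔
              ((p : ℤ) ^ a) • kolyvaginClass (W.baseChange K) _ hdiv (hA (m / ℓ)) (Pt (m / ℓ))
                  (hPt (m / ℓ)) ∈
                (W.baseChange K).torsionLocalKer (v.adicCompletion K) ((p ^ M : ℕ) : ℤ)))) :=
  hpointsRk_of_shimuraLabels hK ι hN Dt hp hp2 hρ y hε hB2 hB3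
    (isOfFinAddOrder_map_sub_smul_of_labels hK ι y hB2 hB3) hB4 hB5

end Summit.BirchSwinnertonDyer.BirchSwinnertonDyer.Theorems.ShimuraKolyvaginConjKLevel

end
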